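import Summits.PneNP.PneNP.Theses.SymmetryBudget
import Summits.PneNP.PneNP.Theorems.SymmetryBudgetRigidBenchmarkCalibration
import Literature.Computability.Complexity.SymmetricColourRefinementCanonical
import Literature.Computability.Complexity.SymmetricCircuitCompose
import Literature.Computability.Complexity.CircuitInputMap

/-!
# Calibration of `SymmetryBudget.RigidBenchmark` (item stmt-PneNP-2149), II:
# the benchmark implies a PLAIN circuit lower bound for 3-colourability

The planner files `RigidBenchmark` ("no poly-size FULLY symmetric threshold circuit agrees with
3-colourability on all colour-refinement-discrete inputs, i.o.") as calibration, claiming it is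
equivalent to `NP ⊄ P/poly`. This file proves the substantive half of that claim inside the
route's own matrix-input model:

  `rigidBenchmark_imp_threeColHardIO : RigidBenchmark →
     ∀ q, ∃ᶠ m, ¬ ∃ D over tcBasis, |D| ≤ q m ∧ D computes x ↦ [Gr x is 3-colourable]`

— the benchmark is AT LEAST AS STRONG as a superpolynomial lower bound for GENERAL
(non-symmetric, non-uniform) threshold circuits deciding 3-colourability of all `m`-vertex
graphs, i.e. `3COL ∉ SIZE^{tc}(poly)` in the matrix convention (the matrix form of
`NP ⊄ P/poly` for this NP-complete problem). So no "non-Weisfeiler–Leman symmetric technique"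
can settle the benchmark without proving a general circuit lower bound: the symmetry restriction
and the promise to CR-discrete inputs buy no logical room.

The proof is the compilation the planner sketches, made formal: given a general circuit `D` for
3-colourability, the `Sym(Fin m)`-symmetric colour-refinement CANONISATION circuits
(`Literature/Computability/Complexity/SymmetricColourRefinement*.lean`: `m²` circuits of
`22·(m+1)⁵` gates computing the canonical adjacency matrix `canonMatrix m x`, Immerman–Lander's
canonical labelling as an Anderson–Dawar symmetric threshold circuit) are post-composed with `D`
on their automorphism-INVARIANT output wires (`hasSymCircuit_postcompose`,
`SymmetricCircuitCompose.lean`); the result is fully symmetric, of size `22 m² (m+1)⁵ + |D|`, and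
on a CR-discrete input `x` it outputs `D (canonMatrix m x) = [canonGraph (Gr x) is 3-colourable]
= [Gr x is 3-colourable]` (`gr_canonMatrix_colorable_iff`: the canonical form is isomorphic to
`Gr x` there). Polynomial bookkeeping: `p = 22 X² (X+1)⁵ + q`.
-/

-- `Summit.PneNP.PneNP.…` duplicates `PneNP` BY DESIGN (single-problem summit, D-0017); the Summits
-- library sets this option globally (lakefile), repeated here so a standalone `lean check` is warning-free.
set_option linter.dupNamespace false

namespace Summit.PneNP.PneNP.Theorems

open Literature.Computability.Complexity Literature.Computability.Complexity.GateList
open Literature.Combinatorics.SimpleGraph Filter Polynomial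
open Summit.PneNP.PneNP.Theses.SymmetryBudget (RigidBenchmark)
open scoped Classical

/-- **Symmetric compilation at one input length.** From ANY `tcBasis`-circuit `D` deciding
3-colourability of `Gr y` for all `m × m` matrices `y`, a `tcBasis`-circuit that is symmetric
under EVERY permutation of `Fin m`, has at most `m²·22·(m+1)⁵ + |D|` gates, and agrees with
3-colourability of `Gr x` on every CR-discrete input `x` (canonise symmetrically, then run `D` on
the canonical adjacency matrix). -/
theorem exists_symmetric_of_general {m : ℕ} (D : Circuit (Fin m × Fin m)) (hDB : D.IsOver tcBasis)
    (hDc : ∀ y : Fin m × Fin m → Bool, D.eval y = decide ((SymCR.Gr y).Colorable 3)) :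
    ∃ C : Circuit (Fin m × Fin m), C.IsOver tcBasis ∧
      C.size ≤ m * m * (22 * ((m + 1) ^ 4 * (m + 1))) + D.size ∧
      C.IsSymmetricUnder Set.univ ∧
      ∀ x : Fin m × Fin m → Bool, IsCRDiscrete (SymCR.Gr x) →
        C.eval x = decide ((SymCR.Gr x).Colorable 3) := by
  obtain ⟨Cs, hCs⟩ := SymCR.exists_symmetric_canonMatrix_circuits (m := m) m
    (Set.univ : Set (Equiv.Perm (Fin m)))
  obtain ⟨C, hB, hs, hS, hc⟩ := hasSymCircuit_postcompose (Γ := (Set.univ : Set (Equiv.Perm (Fin m))))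
    (B := tcBasis) (r := m * m) (s := 22 * ((m + 1) ^ 4 * (m + 1)))
    (fun i => Cs (finProdFinEquiv.symm i))
    (fun i x => SymCR.canonMatrix m x (finProdFinEquiv.symm i))
    (fun i => (hCs _).1) (fun i => (hCs _).2.1) (fun i => (hCs _).2.2.1) (fun i => (hCs _).2.2.2)
    (D.mapInputs finProdFinEquiv) (hDB.mapInputs _) (h := (D.mapInputs finProdFinEquiv).eval)
    (fun _ => rfl)
  refine ⟨C, hB, by simpa using hs, hS, fun x hx => ?_⟩
  rw [hc x]
  beta_reduce
  rw [Circuit.eval_mapInputs]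
  have hfun : (fun q : Fin m × Fin m =>
      SymCR.canonMatrix m x (finProdFinEquiv.symm (finProdFinEquiv q))) = SymCR.canonMatrix m x := by
    funext q
    rw [Equiv.symm_apply_apply]
  rw [hfun, hDc, SymCR.gr_canonMatrix_colorable_iff hx (Nat.le_succ m)]

/-- **`RigidBenchmark` implies the plain circuit lower bound for 3-colourability.** If for every
polynomial `p`, frequently in `m`, no fully symmetric `tcBasis`-circuit of size `≤ p m` agrees
with 3-colourability on the CR-discrete inputs, then for every polynomial `q`, frequently in `m`,
NO `tcBasis`-circuit WHATSOEVER of size `≤ q m` computes 3-colourability of `Gr x` for all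
`m × m` matrices `x` — a general (non-symmetric, non-uniform) superpolynomial circuit lower bound
for an NP-complete problem, in the route's matrix-input convention. -/
theorem rigidBenchmark_imp_threeColHardIO (h : RigidBenchmark) (q : Polynomial ℕ) :
    ∃ᶠ m in atTop, ¬ ∃ D : Circuit (Fin m × Fin m), D.IsOver tcBasis ∧ D.size ≤ q.eval m ∧
      ∀ x : Fin m × Fin m → Bool,
        D.eval x = decide ((SimpleGraph.fromRel fun u v => x (u, v) = true :
          SimpleGraph (Fin m)).Colorable 3) := by
  set p : Polynomial ℕ := 22 * X ^ 2 * (X + 1) ^ 5 + q with hp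
  have hfr := (rigidBenchmark_iff.1 h) p
  by_contra hcon
  rw [Filter.not_frequently] at hcon
  simp only [not_not] at hcon
  obtain ⟨m, hnoC, D, hDB, hDs, hDc⟩ := (hfr.and_eventually hcon).exists
  obtain ⟨C, hB, hs, hS, hc⟩ := exists_symmetric_of_general D hDB hDc
  refine hnoC ⟨C, hB, ?_, hS, hc⟩
  have heval : p.eval m = 22 * m ^ 2 * (m + 1) ^ 5 + q.eval m := by
    simp [hp]
  rw [heval]
  have hring : m * m * (22 * ((m + 1) ^ 4 * (m + 1))) = 22 * m ^ 2 * (m + 1) ^ 5 := by ring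
  omega

/-- The same with the `HasSymCircuit`-style phrasing of the conclusion: `RigidBenchmark` denies
`ThreeColPolySize := ∃ q, ∀ m, ∃ D over tcBasis, |D| ≤ q m ∧ D computes 3COL_m` — polynomial-size
general threshold circuits for 3-colourability at every length. -/
theorem rigidBenchmark_not_threeColPolySize (h : RigidBenchmark) :
    ¬ ∃ q : Polynomial ℕ, ∀ m : ℕ, ∃ D : Circuit (Fin m × Fin m), D.IsOver tcBasis ∧
      D.size ≤ q.eval m ∧ D.Computes (fun x : Fin m × Fin m → Bool =>
        decide ((SimpleGraph.fromRel fun u v => x (u, v) = true : SimpleGraph (Fin m)).Colorable 3)) := by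
  rintro ⟨q, hq⟩
  obtain ⟨m, hm⟩ := (rigidBenchmark_imp_threeColHardIO h q).exists
  exact hm (hq m)

end Summit.PneNP.PneNP.Theorems
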